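import Mathlib
import Literature.MathematicalPhysics.QuantumLattice.GrassmannIntegral
import Literature.MathematicalPhysics.QuantumLattice.GrassmannIntegralProofs
import Literature.MathematicalPhysics.QuantumLattice.GaugeGroups
import Summits.QuantumFields.QCD.Theses.WilsonMobilityGap

/-!
# Route `WilsonMobilityGap`, support item `SupercriticalSignWitness` (stmt-QuantumFields-9153)

For every bare mass `m ∈ (-1, 0)` there is a torus and an `SU(3)` lattice gauge field on it whose
`r = 1` Wilson–Dirac fermion determinant has negative real part.

## The witness

The torus is the ONE-SITE torus (`L = 0`, side `2 · 0 + 1 = 1`), on which the four links are four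
`SU(3)` matrices `U_μ` and the Wilson–Dirac operator is the `12 × 12` matrix
`D = (m + 4) - ½ Σ_μ [(1 - γ_μ) ⊗ U_μ + (1 + γ_μ) ⊗ U_μ⁻¹]`.  With `c = cos φ`, `s = sin φ` we take the
"hub-and-spokes" field
`U₀ = exp(iφσʸ) ⊂ SU(2)₀₁`, `U₁ = exp(iφσʸ) ⊂ SU(2)₀₂`, `U₂ = exp(-iφσˣ) ⊂ SU(2)₀₁`,
`U₃ = exp(iφσˣ) ⊂ SU(2)₀₂` (`link_mem`): colour `0` is coupled to colours `1` and `2`, which are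
not coupled to each other.  In the colour blocks `0 | 1, 2` the operator is
`D = ( a·1₄, B ; C, d·1₈ )` with `a = m + 4(1 - c)`, `d = m + 2(1 - c)`,
`B = s (γ₀ - iγ₂ | γ₁ + iγ₃)`, `C = -s (γ₀ + iγ₂ ; γ₁ - iγ₃)` and
`B C = -s² (4 + 2iγ₀γ₂ - 2iγ₁γ₃)`, whose spectrum is `-s² {4, 4, 8, 0}` (the `γ₅` constraint
`(iγ₀γ₂)(iγ₁γ₃) = γ₅` makes the eigenvalue `0` simple).  Block elimination gives the closed form

  `det D = a · d⁵ · (a d + 4 s²)² · (a d + 8 s²)`,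

negative exactly for `2(1 - c) < |m| < 4(1 - c)`.  Choosing `c = 1 + m/3` (so `a = -m/3 > 0`,
`d = m/3 < 0`) gives `det D < 0` for every `m ∈ (-1, 0)` (indeed for every `m ∈ (-6, 0)`).

Why the witness must depend on `m`: for a FIXED gauge field `det D_W(U, m, 1) > 0` for all `m < 0`
close enough to `0` (zero modes of `D_W(U, 0, 1)` are covariantly constant, of multiplicity `4k`
and semisimple), so no finite list of configurations covers `m → 0⁻`; here `φ → 0` as `m → 0⁻`.

## Lean route (no definitions: the witness data is written out where it is used)

`entry00` … `entry22` evaluate the nine colour blocks and `blockForm` reindexes `site × colour × spin ≃ spin ⊕ (spin ⊕ spin)` (hub | spokes) and identifies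
the one-site operator with the block matrix (`144` entries, evaluated with the explicit gamma
matrices `euclideanGamma_zero` … `_three` of the tree); `det_fromBlocks_smul_one` is the block
elimination `( a1, B ; C, d1 ) · ( d1, 0 ; -C, 1 ) = ( ad·1 - BC, B ; 0, d1 )`; `det_hubBlock`
evaluates the remaining `4 × 4` determinant; `det_witness` is the closed form and
`supercriticalSignWitness_proof` the sign.
-/

noncomputable section

open Matrix Complex
open Literature.MathematicalPhysics.QuantumLattice Literature.MathematicalPhysics.QuantumFieldTheory
  Literature.Probability.LatticeModels

namespace Summit.QuantumFields.QCD.Theorems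

namespace SupercriticalSignWitness

/-- The four hub-and-spokes links `U₀ = exp(iφσʸ)₀₁`, `U₁ = exp(iφσʸ)₀₂`, `U₂ = exp(-iφσˣ)₀₁`,
`U₃ = exp(iφσˣ)₀₂` (`c = cos φ`, `s = sin φ`, written as an `if` cascade in the direction `μ`)
are special unitary when `c² + s² = 1`. -/
theorem link_mem (c s : ℝ) (h : c ^ 2 + s ^ 2 = 1) (μ : Fin 4) :
    (if μ = 0 then !![(c : ℂ), s, 0; -(s : ℂ), c, 0; 0, 0, 1]
      else if μ = 1 then !![(c : ℂ), 0, s; 0, 1, 0; -(s : ℂ), 0, c]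
      else if μ = 2 then !![(c : ℂ), -(I * s), 0; -(I * s), c, 0; 0, 0, 1]
      else !![(c : ℂ), 0, I * s; 0, 1, 0; I * s, 0, c] : Matrix (Fin 3) (Fin 3) ℂ) ∈
      Matrix.specialUnitaryGroup (Fin 3) ℂ := by
  rw [Matrix.mem_specialUnitaryGroup_iff, Matrix.mem_unitaryGroup_iff]
  fin_cases μ <;> constructor
  · ext i j
    fin_cases i <;> fin_cases j <;>
      simp [Matrix.mul_apply, Fin.sum_univ_three, Complex.ext_iff] <;> nlinarith [h]
  · simp [Matrix.det_fin_three, Complex.ext_iff]; nlinarith [h]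
  · ext i j
    fin_cases i <;> fin_cases j <;>
      simp [Matrix.mul_apply, Fin.sum_univ_three, Complex.ext_iff] <;> nlinarith [h]
  · simp [Matrix.det_fin_three, Complex.ext_iff]; nlinarith [h]
  · ext i j
    fin_cases i <;> fin_cases j <;>
      simp [Matrix.mul_apply, Fin.sum_univ_three, Complex.ext_iff] <;> nlinarith [h]
  · simp [Matrix.det_fin_three, Complex.ext_iff]; nlinarith [h]
  · ext i j
    fin_cases i <;> fin_cases j <;>
      simp [Matrix.mul_apply, Fin.sum_univ_three, Complex.ext_iff] <;> nlinarith [h]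
  · simp [Matrix.det_fin_three, Complex.ext_iff]; nlinarith [h]

/-- In `SU(3)` the inverse is the conjugate transpose (`Matrix.star_eq_inv`). -/
@[simp] theorem specialUnitaryGroup_inv_val (A : Matrix.specialUnitaryGroup (Fin 3) ℂ) :
    (A⁻¹).1 = star A.1 :=
  congrArg Subtype.val (Matrix.star_eq_inv A).symm

/-- On the one-site torus every shifted site is the site itself. -/
theorem shift_eq (x : TorusSite 4 1) (μ : Fin 4) :
    Literature.MathematicalPhysics.QuantumFieldTheory.Site.shift x μ = x :=
  Subsingleton.elim _ _

/-! ### The colour blocks of the one-site operator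

The gauge field is `fun l => ⟨_, link_mem c s h l.2⟩` (the links of `link_mem`, the matrix being
read off from that lemma); each `4 × 4` colour block `(a, b)` is evaluated entrywise. -/
/-- Colour block `(0,0)` of the one-site Wilson–Dirac operator: the hub mass `(m + 4(1 - c)) · 1`. -/
theorem entry00 (m c s : ℝ) (h : c ^ 2 + s ^ 2 = 1) (x y : TorusSite 4 1) (α β : Fin 4) :
    wilsonDirac (fundamentalRep (Fin 3)) (fun l => ⟨_, link_mem c s h l.2⟩) m 1 (x, 0, α)
      (y, 0, β) = ((((m + 4 * (1 - c) : ℝ) : ℂ)) • (1 : Matrix (Fin 4) (Fin 4) ℂ)) α β := by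
  obtain rfl : x = y := Subsingleton.elim x y
  fin_cases α <;> fin_cases β <;>
    simp [shift_eq, wilsonDirac, Fin.sum_univ_four, euclideanGamma_zero, euclideanGamma_one,
      euclideanGamma_two, euclideanGamma_three, Matrix.one_apply] <;>
    ring_nf

/-- Colour block `(0,1)` of the one-site Wilson–Dirac operator: `s (γ₀ - iγ₂)`. -/
theorem entry01 (m c s : ℝ) (h : c ^ 2 + s ^ 2 = 1) (x y : TorusSite 4 1) (α β : Fin 4) :
    wilsonDirac (fundamentalRep (Fin 3)) (fun l => ⟨_, link_mem c s h l.2⟩) m 1 (x, 0, α)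
      (y, 1, β) = !![0, 0, -(s : ℂ), -(I * s); 0, 0, -(I * s), s; s, I * s, 0, 0; I * s, -(s : ℂ), 0, 0] α β := by
  obtain rfl : x = y := Subsingleton.elim x y
  fin_cases α <;> fin_cases β <;>
    simp [shift_eq, wilsonDirac, Fin.sum_univ_four, euclideanGamma_zero, euclideanGamma_one,
      euclideanGamma_two, euclideanGamma_three, Matrix.one_apply] <;>
    (try ring_nf) <;> (try simp only [Complex.I_sq]) <;> (try ring_nf)

/-- Colour block `(0,2)` of the one-site Wilson–Dirac operator: `s (γ₁ + iγ₃)`. -/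
theorem entry02 (m c s : ℝ) (h : c ^ 2 + s ^ 2 = 1) (x y : TorusSite 4 1) (α β : Fin 4) :
    wilsonDirac (fundamentalRep (Fin 3)) (fun l => ⟨_, link_mem c s h l.2⟩) m 1 (x, 0, α)
      (y, 2, β) = !![0, 0, I * s, -(s : ℂ); 0, 0, s, I * s; I * s, s, 0, 0; -(s : ℂ), I * s, 0, 0] α β := by
  obtain rfl : x = y := Subsingleton.elim x y
  fin_cases α <;> fin_cases β <;>
    simp [shift_eq, wilsonDirac, Fin.sum_univ_four, euclideanGamma_zero, euclideanGamma_one,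
      euclideanGamma_two, euclideanGamma_three, Matrix.one_apply] <;>
    (try ring_nf)

/-- Colour block `(1,0)` of the one-site Wilson–Dirac operator: `-s (γ₀ + iγ₂)`. -/
theorem entry10 (m c s : ℝ) (h : c ^ 2 + s ^ 2 = 1) (x y : TorusSite 4 1) (α β : Fin 4) :
    wilsonDirac (fundamentalRep (Fin 3)) (fun l => ⟨_, link_mem c s h l.2⟩) m 1 (x, 1, α)
      (y, 0, β) = !![0, 0, -(s : ℂ), I * s; 0, 0, I * s, s; s, -(I * s), 0, 0; -(I * s), -(s : ℂ), 0, 0] α β := by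
  obtain rfl : x = y := Subsingleton.elim x y
  fin_cases α <;> fin_cases β <;>
    simp [shift_eq, wilsonDirac, Fin.sum_univ_four, euclideanGamma_zero, euclideanGamma_one,
      euclideanGamma_two, euclideanGamma_three, Matrix.one_apply] <;>
    (try ring_nf) <;> (try simp only [Complex.I_sq]) <;> (try ring_nf)

/-- Colour block `(1,1)` of the one-site Wilson–Dirac operator: the spoke mass `(m + 2(1 - c)) · 1`. -/
theorem entry11 (m c s : ℝ) (h : c ^ 2 + s ^ 2 = 1) (x y : TorusSite 4 1) (α β : Fin 4) :
    wilsonDirac (fundamentalRep (Fin 3)) (fun l => ⟨_, link_mem c s h l.2⟩) m 1 (x, 1, α)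
      (y, 1, β) = ((((m + 2 * (1 - c) : ℝ) : ℂ)) • (1 : Matrix (Fin 4) (Fin 4) ℂ)) α β := by
  obtain rfl : x = y := Subsingleton.elim x y
  fin_cases α <;> fin_cases β <;>
    simp [shift_eq, wilsonDirac, Fin.sum_univ_four, euclideanGamma_zero, euclideanGamma_one,
      euclideanGamma_two, euclideanGamma_three, Matrix.one_apply] <;>
    (try ring_nf)

/-- Colour block `(1,2)` of the one-site Wilson–Dirac operator: `0` (the spokes are not coupled). -/
theorem entry12 (m c s : ℝ) (h : c ^ 2 + s ^ 2 = 1) (x y : TorusSite 4 1) (α β : Fin 4) :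
    wilsonDirac (fundamentalRep (Fin 3)) (fun l => ⟨_, link_mem c s h l.2⟩) m 1 (x, 1, α)
      (y, 2, β) = (0 : ℂ) := by
  obtain rfl : x = y := Subsingleton.elim x y
  fin_cases α <;> fin_cases β <;>
    simp [shift_eq, wilsonDirac, Fin.sum_univ_four, euclideanGamma_zero, euclideanGamma_one,
      euclideanGamma_two, euclideanGamma_three, Matrix.one_apply]

/-- Colour block `(2,0)` of the one-site Wilson–Dirac operator: `-s (γ₁ - iγ₃)`. -/
theorem entry20 (m c s : ℝ) (h : c ^ 2 + s ^ 2 = 1) (x y : TorusSite 4 1) (α β : Fin 4) :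
    wilsonDirac (fundamentalRep (Fin 3)) (fun l => ⟨_, link_mem c s h l.2⟩) m 1 (x, 2, α)
      (y, 0, β) = !![0, 0, I * s, s; 0, 0, -(s : ℂ), I * s; I * s, -(s : ℂ), 0, 0; s, I * s, 0, 0] α β := by
  obtain rfl : x = y := Subsingleton.elim x y
  fin_cases α <;> fin_cases β <;>
    simp [shift_eq, wilsonDirac, Fin.sum_univ_four, euclideanGamma_zero, euclideanGamma_one,
      euclideanGamma_two, euclideanGamma_three, Matrix.one_apply] <;>
    (try ring_nf)

/-- Colour block `(2,1)` of the one-site Wilson–Dirac operator: `0` (the spokes are not coupled). -/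
theorem entry21 (m c s : ℝ) (h : c ^ 2 + s ^ 2 = 1) (x y : TorusSite 4 1) (α β : Fin 4) :
    wilsonDirac (fundamentalRep (Fin 3)) (fun l => ⟨_, link_mem c s h l.2⟩) m 1 (x, 2, α)
      (y, 1, β) = (0 : ℂ) := by
  obtain rfl : x = y := Subsingleton.elim x y
  fin_cases α <;> fin_cases β <;>
    simp [shift_eq, wilsonDirac, Fin.sum_univ_four, euclideanGamma_zero, euclideanGamma_one,
      euclideanGamma_two, euclideanGamma_three, Matrix.one_apply]

/-- Colour block `(2,2)` of the one-site Wilson–Dirac operator: the spoke mass `(m + 2(1 - c)) · 1`. -/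
theorem entry22 (m c s : ℝ) (h : c ^ 2 + s ^ 2 = 1) (x y : TorusSite 4 1) (α β : Fin 4) :
    wilsonDirac (fundamentalRep (Fin 3)) (fun l => ⟨_, link_mem c s h l.2⟩) m 1 (x, 2, α)
      (y, 2, β) = ((((m + 2 * (1 - c) : ℝ) : ℂ)) • (1 : Matrix (Fin 4) (Fin 4) ℂ)) α β := by
  obtain rfl : x = y := Subsingleton.elim x y
  fin_cases α <;> fin_cases β <;>
    simp [shift_eq, wilsonDirac, Fin.sum_univ_four, euclideanGamma_zero, euclideanGamma_one,
      euclideanGamma_two, euclideanGamma_three, Matrix.one_apply] <;>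
    (try ring_nf)

/-- **Block form.** The gauge field with links `link_mem` on the one-site torus, reindexed by
`site × colour × spin ≃ spin ⊕ (spin ⊕ spin)` (hub colour `0` | spoke colours `1, 2`), has
Wilson–Dirac operator `( a·1, B ; C, d·1 )` with `a = m + 4(1 - c)`, `d = m + 2(1 - c)`,
`B = s (γ₀ - iγ₂ | γ₁ + iγ₃)`, `C = -s (γ₀ + iγ₂ ; γ₁ - iγ₃)`. -/
theorem blockForm (m c s : ℝ) (h : c ^ 2 + s ^ 2 = 1) :
    ∃ (U : GaugeConfig 4 1 (Matrix.specialUnitaryGroup (Fin 3) ℂ))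
      (e : (TorusSite 4 1 × Fin 3 × Fin 4) ≃ (Fin 4 ⊕ (Fin 4 ⊕ Fin 4))),
      reindex e e (wilsonDirac (fundamentalRep (Fin 3)) U m 1) =
        fromBlocks (((m + 4 * (1 - c) : ℝ) : ℂ) • 1)
          (fromCols
            !![0, 0, -(s : ℂ), -(I * s); 0, 0, -(I * s), s; s, I * s, 0, 0; I * s, -(s : ℂ), 0, 0]
            !![0, 0, I * s, -(s : ℂ); 0, 0, s, I * s; I * s, s, 0, 0; -(s : ℂ), I * s, 0, 0])
          (fromRows
            !![0, 0, -(s : ℂ), I * s; 0, 0, I * s, s; s, -(I * s), 0, 0; -(I * s), -(s : ℂ), 0, 0]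
            !![0, 0, I * s, s; 0, 0, -(s : ℂ), I * s; I * s, -(s : ℂ), 0, 0; s, I * s, 0, 0])
          (((m + 2 * (1 - c) : ℝ) : ℂ) • 1) := by
  refine ⟨fun l => ⟨_, link_mem c s h l.2⟩,
    { toFun := fun p => if p.2.1 = 0 then Sum.inl p.2.2
        else if p.2.1 = 1 then Sum.inr (Sum.inl p.2.2) else Sum.inr (Sum.inr p.2.2)
      invFun := Sum.elim (fun α => ((fun _ => 0), 0, α))
        (Sum.elim (fun α => ((fun _ => 0), 1, α)) (fun α => ((fun _ => 0), 2, α)))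
      left_inv := by
        rintro ⟨x, a, α⟩
        obtain rfl : x = fun _ => 0 := Subsingleton.elim _ _
        fin_cases a <;> rfl
      right_inv := by rintro (α | α | α) <;> rfl }, ?_⟩
  ext i j
  rcases i with α | α | α <;> rcases j with β | β | β <;>
    simp only [reindex_apply, submatrix_apply, Equiv.coe_fn_symm_mk, Sum.elim_inl, Sum.elim_inr,
      entry00 m c s h, entry01 m c s h, entry02 m c s h, entry10 m c s h, entry11 m c s h,
      entry12 m c s h, entry20 m c s h, entry21 m c s h, entry22 m c s h] <;>
    simp [Matrix.one_apply]

/-! ### Block elimination and the `4 × 4` determinant -/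

/-- Block elimination for `( a1, B ; C, d1 )` with `d ≠ 0`: multiplying on the right by
`( d1, 0 ; -C, 1 )` gives `( ad·1 - BC, B ; 0, d1 )`, whence
`det = det(ad·1 - BC) · d^{#q} / d^{#p}`. -/
theorem det_fromBlocks_smul_one {p q : Type*} [Fintype p] [Fintype q] [DecidableEq p]
    [DecidableEq q] (a d : ℂ) (B : Matrix p q ℂ) (C : Matrix q p ℂ) (hd : d ≠ 0) :
    (fromBlocks (a • (1 : Matrix p p ℂ)) B C (d • 1)).det =
      ((a * d) • (1 : Matrix p p ℂ) - B * C).det * d ^ Fintype.card q / d ^ Fintype.card p := by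
  have key : fromBlocks (a • (1 : Matrix p p ℂ)) B C (d • 1) * fromBlocks (d • 1) 0 (-C) 1 =
      fromBlocks ((a * d) • 1 - B * C) B 0 (d • 1) := by
    rw [fromBlocks_multiply]
    simp [Matrix.mul_smul, Matrix.smul_mul, smul_smul, sub_eq_add_neg, mul_comm a d]
  have h := congrArg Matrix.det key
  rw [det_mul, det_fromBlocks_zero₁₂, det_fromBlocks_zero₂₁] at h
  simp only [det_smul, Matrix.det_one, mul_one] at h
  rw [eq_div_iff (pow_ne_zero _ hd), h]

/-- The `4 × 4` determinant `det ( u, 0, 0, 0 ; 0, u, 0, 0 ; 0, 0, u, -v ; 0, 0, v, u ) =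
u² (u² + v²)`. -/
theorem det_four_aux (u v : ℂ) :
    !![u, 0, 0, 0; 0, u, 0, 0; 0, 0, u, -v; 0, 0, v, u].det = u ^ 2 * (u ^ 2 + v ^ 2) := by
  simp [Matrix.det_succ_row_zero, Fin.sum_univ_succ]
  ring

/-- The hub determinant after elimination: with `B C = -s² (4 + 2iγ₀γ₂ - 2iγ₁γ₃)`,
`det(t·1 - BC) = (t + 4s²)² · t · (t + 8s²)`. -/
theorem det_hubBlock (t s : ℝ) :
    (((t : ℝ) : ℂ) • (1 : Matrix (Fin 4) (Fin 4) ℂ) -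
      fromCols
          !![0, 0, -(s : ℂ), -(I * s); 0, 0, -(I * s), s; s, I * s, 0, 0; I * s, -(s : ℂ), 0, 0]
          !![0, 0, I * s, -(s : ℂ); 0, 0, s, I * s; I * s, s, 0, 0; -(s : ℂ), I * s, 0, 0] *
        fromRows
          !![0, 0, -(s : ℂ), I * s; 0, 0, I * s, s; s, -(I * s), 0, 0; -(I * s), -(s : ℂ), 0, 0]
          !![0, 0, I * s, s; 0, 0, -(s : ℂ), I * s; I * s, -(s : ℂ), 0, 0; s, I * s, 0, 0]).det =
      (((t + 4 * s ^ 2) ^ 2 * (t * (t + 8 * s ^ 2)) : ℝ) : ℂ) := by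
  rw [fromCols_mul_fromRows]
  have hmat : ((t : ℝ) : ℂ) • (1 : Matrix (Fin 4) (Fin 4) ℂ) -
      (!![0, 0, -(s : ℂ), -(I * s); 0, 0, -(I * s), s; s, I * s, 0, 0; I * s, -(s : ℂ), 0, 0] *
          !![0, 0, -(s : ℂ), I * s; 0, 0, I * s, s; s, -(I * s), 0, 0; -(I * s), -(s : ℂ), 0, 0] +
        !![0, 0, I * s, -(s : ℂ); 0, 0, s, I * s; I * s, s, 0, 0; -(s : ℂ), I * s, 0, 0] *
          !![0, 0, I * s, s; 0, 0, -(s : ℂ), I * s; I * s, -(s : ℂ), 0, 0; s, I * s, 0, 0]) =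
      !![(t : ℂ) + 4 * (s : ℂ) ^ 2, 0, 0, 0; 0, (t : ℂ) + 4 * (s : ℂ) ^ 2, 0, 0;
        0, 0, (t : ℂ) + 4 * (s : ℂ) ^ 2, -(4 * (s : ℂ) ^ 2 * I);
        0, 0, 4 * (s : ℂ) ^ 2 * I, (t : ℂ) + 4 * (s : ℂ) ^ 2] := by
    ext i j
    fin_cases i <;> fin_cases j <;> simp <;>
      (try ring_nf) <;> (try simp only [Complex.I_sq]) <;> (try ring_nf)
  rw [hmat, det_four_aux]
  push_cast
  have hI : I ^ 2 = -1 := Complex.I_sq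
  linear_combination (16 * (s : ℂ) ^ 4 * ((t : ℂ) + 4 * (s : ℂ) ^ 2) ^ 2) * hI

/-- **Closed form of the one-site determinant**: the hub-and-spokes field has
`det D_W(U, m, 1) = a · d⁵ · (ad + 4s²)² · (ad + 8s²)`, `a = m + 4(1 - c)`, `d = m + 2(1 - c)`
(stated for `d ≠ 0`, which is all the witness needs). -/
theorem det_witness (m c s : ℝ) (h : c ^ 2 + s ^ 2 = 1) (hd : m + 2 * (1 - c) ≠ 0) :
    ∃ U : GaugeConfig 4 1 (Matrix.specialUnitaryGroup (Fin 3) ℂ),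
      (wilsonDirac (fundamentalRep (Fin 3)) U m 1).det =
        (((m + 4 * (1 - c)) * (m + 2 * (1 - c)) ^ 5 *
          ((m + 4 * (1 - c)) * (m + 2 * (1 - c)) + 4 * s ^ 2) ^ 2 *
          ((m + 4 * (1 - c)) * (m + 2 * (1 - c)) + 8 * s ^ 2) : ℝ) : ℂ) := by
  obtain ⟨U, e, he⟩ := blockForm m c s h
  refine ⟨U, ?_⟩
  have hd' : ((m + 2 * (1 - c) : ℝ) : ℂ) ≠ 0 := by exact_mod_cast hd
  rw [← det_reindex_self e, he, det_fromBlocks_smul_one _ _ _ _ hd']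
  have hprod : ((m + 4 * (1 - c) : ℝ) : ℂ) * ((m + 2 * (1 - c) : ℝ) : ℂ) =
      (((m + 4 * (1 - c)) * (m + 2 * (1 - c)) : ℝ) : ℂ) := by push_cast; ring
  rw [hprod, det_hubBlock]
  simp only [Fintype.card_sum, Fintype.card_fin]
  rw [div_eq_iff (pow_ne_zero 4 hd')]
  push_cast
  ring

end SupercriticalSignWitness

open SupercriticalSignWitness in
/-- **Route item `SupercriticalSignWitness`** (stmt-QuantumFields-9153): for every bare mass
`m ∈ (-1, 0)` there are a torus (the one-site torus, `L = 0`) and an `SU(3)` gauge field on it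
(the hub-and-spokes field with `cos φ = 1 + m/3`) with `Re det D_W(U, m, 1) < 0`, by the closed
form `det = a d⁵ (ad + 4s²)² (ad + 8s²)` with `a = -m/3 > 0`, `d = m/3 < 0` (`det_witness`). -/
theorem supercriticalSignWitness_proof :
    Summit.QuantumFields.QCD.Theses.WilsonMobilityGap.SupercriticalSignWitness := by
  unfold Summit.QuantumFields.QCD.Theses.WilsonMobilityGap.SupercriticalSignWitness
  intro m hm1 hm0
  set c : ℝ := 1 + m / 3 with hc
  have hc2 : 0 ≤ 1 - c ^ 2 := by rw [hc]; nlinarith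
  set s : ℝ := Real.sqrt (1 - c ^ 2) with hs
  have hs2 : s ^ 2 = 1 - c ^ 2 := by rw [hs]; exact Real.sq_sqrt hc2
  have h : c ^ 2 + s ^ 2 = 1 := by linarith
  have hd : m + 2 * (1 - c) ≠ 0 := by rw [hc]; intro h0; linarith
  obtain ⟨U, hU⟩ := det_witness m c s h hd
  refine ⟨0, U, ?_⟩
  show (Matrix.det (wilsonDirac (fundamentalRep (Fin 3)) U m 1)).re < 0
  rw [hU, Complex.ofReal_re]
  have ha : 0 < m + 4 * (1 - c) := by rw [hc]; linarith
  have hdneg : m + 2 * (1 - c) < 0 := by rw [hc]; linarith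
  have h4 : 0 < (m + 4 * (1 - c)) * (m + 2 * (1 - c)) + 4 * s ^ 2 := by
    rw [hs2, hc]; nlinarith
  have h8 : 0 < (m + 4 * (1 - c)) * (m + 2 * (1 - c)) + 8 * s ^ 2 := by
    rw [hs2, hc]; nlinarith
  have hodd : (m + 2 * (1 - c)) ^ 5 < 0 := Odd.pow_neg (by decide) hdneg
  have hpos : 0 < (m + 4 * (1 - c)) *
      ((m + 4 * (1 - c)) * (m + 2 * (1 - c)) + 4 * s ^ 2) ^ 2 *
      ((m + 4 * (1 - c)) * (m + 2 * (1 - c)) + 8 * s ^ 2) := by positivity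
  nlinarith [mul_neg_of_pos_of_neg hpos hodd]

end Summit.QuantumFields.QCD.Theorems
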